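import Literature.AnabelianGeometry.EtaleTheta.ArithThetaTowerCThetaUnits
import HarnessLib

/-!
# [IUTchI] Ex. 3.2 (iv) at the ARITHMETIC theta tower, part 1: GENUINE CONSTANTS AS CONSTANT FUNCTIONS OF THE HULL
# `𝒞_v = ℱ̲_v^{bs-fld}` and the `𝒟⊢_v ⊆ 𝒟_v` plumbing of `𝒞⊢_v` (item GA-13, file 1/2)

S. Mochizuki, *Inter-universal Teichmüller Theory I* [Mochizuki2012], Ex. 3.2 (iv) p.71: «`Φ_{𝒞⊢_v} := ℕ·log_Φ(q̲_v)|_{𝒟⊢_v}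
⊆ Φ_{𝒞_v}|_{𝒟⊢_v}` … `𝒞⊢_v (⊆ 𝒞_v ⊆ ℱ̲_v)`» [claim: Mochizuki2012, status: disputed] (D-0012 claim key; DEFINITIONS only,
nothing of the series asserted); *The étale theta function …* [MochizukiEtTh2009] Def. 3.6 (iv) p.78 (the base-field-theoretic
hull: model Frobenioid of `(𝒟, Φ^{bs-fld}, F, F → (Φ^{bs-fld})^gp)`); *The geometry of Frobenioids II* [MochizukiFrdII2008]
Ex. 1.1 (ii) p.8 (the monogenic `p_v`-adic Frobenioid `(ℕ·log_Φ(c), B^c)` of a constant section).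

GAP A of record G-L5-EX32I-1 (abc-iut cell), item GA-13 = sub-gap (a) proper of row D6 of GAP-SIZING-A.md 69de97346848d3e8;
ruled shape `plan/L5/GAP-A-SIGNATURES.md` v1 e3ccddf9b87597cf §0/§5 (RULINGS #331: over the BINDERS `(C) (hC : CarrierSpec d T C)`,
never over the term; #341 (B)).  This is FILE 1/2 (the 400-line lint): the object-level plumbing that the functor
`cdashToC : d.Cdash hq ⥤ C.hullCategory` of FILE 2/2 (`ArithThetaTowerCdashFaithful.lean`) is assembled from.  Imports GA-06's
`ArithThetaTowerCThetaUnits` (★ p671230) for `CarrierSpec.baseIso_op_comp` / `pull_ofLattice` (naturality of the lattice map).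

WHAT IS HERE (over the §0 binders and `{T'} {VD} {C} (hC : CarrierSpec d T C)`; constants ALWAYS via `T.proj ⋙ d.fieldFunctor`
= `(Ω^{aug X})^×` / `GaloisValDatum.fixedFld`, NOT via `rebase` — crit-A F2, RULINGS #321/#322 (c2′)):
* §1 `CarrierSpec.constDivBsFld hC X : ord(𝒪^▷_{Ω^{aug X}}) → Φ^{bs-fld}(X)` — GENUINE VALUATIONS AS BASE-FIELD-THEORETIC DIVISORS at
  EVERY object `X` of `𝒟_v̲` (`ι` of `hC.consts` then the lattice map; in `ℝ·Φ₀^cnst` because `Div` of a genuine constant IS its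
  valuation), natural in `X` (`pull_constDivBsFld`, genuine ramification); `CarrierSpec.constCnstFn hC X : (Ω^{aug X})^× → F^{bs}(X)`
  — GENUINE CONSTANTS AS CONSTANT FUNCTIONS OF THE HULL, `u ↦ (κ u, ι^gp(ord u))`, injective, natural (`cnstFnBsPull_constCnstFn`),
  and `C.hullUnitM (constCnstFn u) = constRatFn hC X u` (GA-06's constants-as-rational-functions BY NAME).
* §2 the `𝒟⊢_v̲ ⊆ 𝒟_v̲` plumbing of the REAL `GaloisValDatum.Cdash hq`: `logqOrd` (`ord(q̲_v)` at `X`, a constant section),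
  `inclCounit`/`counitFieldHom` (the counit `T.proj (T.incl V) ⟶ V` of `T.adj` and its field map `Ω^V → Ω^{aug(aug⁻¹V)}`:
  injective, valuative, natural), `cdashExp` (`n·log_Φ(q̲_v) ↦ n·ord(q̲_v)`, with `realificationOf_comp_cdashExp`), the
  fibre-product condition of `B^c` (`divZeroHom_eq_of_mem_BSub`), and `Cdash.unit_eq_of_fst_eq`/`Cdash.div_eq_of_eq`: a
  morphism of `𝒞⊢_v̲` is determined by `deg_Fr`, `Base` and the `K^×`-component of its unit.
carrier: genuine-by-[EtTh]-recipe on the T-lattice (Ÿ_T, Ÿ_T × V, X̲̲_v̲ × V) + constants everywhere; off-lattice Φ via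
`rebase`/pullback; [EtTh] Def 3.3 Φ at general U and print's Ÿ̈/μ_N Kummer levels = FOUNDATIONS 13/14, not claimed (#322 (c3′);
this file defines no carrier, it reads the one `hC` specifies).
HONEST FRAMING: monoid/functor plumbing over a `Prop`-valued spec at OUR typed objects; TYPED ≠ INHABITED (the term is GA-12's)
≠ proved-in-print; an UNDISPUTED construction around [IUTchIII] Cor. 3.12, which stays OPEN by charter (D-0045) — no side taken
on it or on any author; nothing here asserts the abc conjecture proved or refuted; count-neutral.  No instance, no notation,
no `sorry`.
-/

noncomputable section

namespace Literature.AnabelianGeometry.EtaleTheta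

namespace ArithThetaTower

open CategoryTheory Opposite Function Literature.AlgebraicGeometry.Frobenioids Literature.AnabelianGeometry.SemiGraphs
  Literature.IUT.HodgeTheaters Literature.AlgebraicGeometry.Frobenioids.PadicFrd

variable {p : ℕ} [Fact p.Prime] (d : GaloisValDatum.{0} p) {P : Type} [Group P] [TopologicalSpace P]
  (T : BadLocalGroupDatum d.Gal P)

variable {d T} {T' : RealifiedDivisorMonoids (D₀ := T.Dv) treeMonoidVocabWeak.{0}} {VD : FrdICatStub.{0, 0, 0} T.Dv}
  {C : TemperedFrobenioid T' T.Dv VD}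
namespace CarrierSpec

/-! ## §1 Genuine valuations as base-field-theoretic divisors; genuine constants as constant functions of the hull -/

/-- Transport along `Y_A = A` commutes with pull-back, for any monoid `F` on `𝒟_v̲` (from GA-06's `baseIso_op_comp`).
[cite: MochizukiEtTh2009, Def 3.6 p.77] -/
theorem map_base_map_transport (hC : CarrierSpec d T C) (F : T.Dvᵒᵖ ⥤ CommMonCat.{0}) {X X' : T.Dv} (g : X ⟶ X')
    (y : F.obj (op X')) :
    (F.map (C.base.map g).op).hom ((F.map (hC.baseIso X').hom.op).hom y) =
      (F.map (hC.baseIso X).hom.op).hom ((F.map g.op).hom y) := by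
  change (F.map (hC.baseIso X').hom.op ≫ F.map (C.base.map g).op).hom y =
    (F.map g.op ≫ F.map (hC.baseIso X).hom.op).hom y
  rw [← F.map_comp, ← F.map_comp, hC.baseIso_op_comp g]

/-- **GENUINE VALUATIONS AS BASE-FIELD-THEORETIC DIVISORS at every object** `X` of `𝒟_v̲`:
`ord(𝒪^▷_{Ω^{aug X}}) → Φ^{bs-fld}(X)`, `ord x ↦` the lattice image of `ι(ord x)` — it lies in `Φ(X)` (`ofLattice`) and
in `ℝ·Φ₀^cnst` because it is `Div` of the genuine constant `κ x ∈ F₀^Λ` (`hC.divΛ_constEmb`, `divΛ_mem_cnstR`).  Through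
`T.proj ⋙ d.fieldFunctor` (constants via `T.proj`/`fixedFld`, NOT via `rebase`; crit-A F2). [cite: MochizukiEtTh2009, Def 3.6 p.78] -/
def constDivBsFld (hC : CarrierSpec d T C) (X : T.Dv) :
    OrdInt (d.fieldFunctor.obj (T.proj.obj X)).K →* C.bsFld.carrier (op X) :=
  ((C.Φ.carrier (op X)).subtype.comp ((hC.ofLattice X).comp (hC.constDivIncl (op X)))).codRestrict
    (C.bsFld.carrier (op X)) fun x => by
      refine ⟨(hC.ofLattice X (hC.constDivIncl (op X) x)).2, ?_⟩
      obtain ⟨q', rfl⟩ := Associates.mk_surjective x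
      have h1 : T'.divΛ (op X) ((hC.constEmb.app (op X)).hom
          (intNonzeroToUnits (d.fieldFunctor.obj (T.proj.obj X)).K q')) =
            Algebra.GrothendieckGroup.of (T'.toR (op X) (hC.constDivIncl (op X) (Associates.mk q'))) := by
        rw [hC.divΛ_constEmb, divUnits_intNonzeroToUnits, gpMap_of, gpMap_of]
      have h2 := T'.divΛ_mem_cnstR (op X) _
        (hC.constEmb_mem_FΛ (op X) (intNonzeroToUnits (d.fieldFunctor.obj (T.proj.obj X)).K q'))
      rw [h1] at h2
      have h3 := T'.cnstR_map (hC.baseIso X).hom.op _ h2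
      rw [gpMap_of] at h3
      change Algebra.GrothendieckGroup.of
        ((hC.ofLattice X (hC.constDivIncl (op X) (Associates.mk q')) : C.Φ.carrier (op X)) :
          T'.ΦR.obj (C.baseOp (op X))) ∈ T'.cnstR (C.baseOp (op X))
      rw [hC.coe_ofLattice]
      exact h3

/-- The value of `constDivBsFld` in `Φ^{ℝ-log}(X) = Φ₀^ℝ(Y_X)`: the transport of `toR (ι x)`. [cite: MochizukiEtTh2009, Def 3.6 p.78] -/
theorem coe_constDivBsFld (hC : CarrierSpec d T C) (X : T.Dv) (x : OrdInt (d.fieldFunctor.obj (T.proj.obj X)).K) :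
    ((hC.constDivBsFld X x : C.bsFld.carrier (op X)) : T'.ΦR.obj (C.baseOp (op X))) =
      (T'.ΦR.map (hC.baseIso X).hom.op).hom (T'.toR (op X) (hC.constDivIncl (op X) x)) :=
  hC.coe_ofLattice X _

/-- `constDivBsFld` followed by `Φ^{bs-fld}(X) ⊆ Φ(X)` is `ofLattice ∘ ι`. [cite: MochizukiEtTh2009, Def 3.6 p.78] -/
theorem bsFldInclM_constDivBsFld (hC : CarrierSpec d T C) (X : T.Dv) (x : OrdInt (d.fieldFunctor.obj (T.proj.obj X)).K) :
    C.bsFldInclM (op X) (hC.constDivBsFld X x) = hC.ofLattice X (hC.constDivIncl (op X) x) :=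
  Subtype.ext rfl

/-- `(Φ^{bs-fld})^gp → (Φ^{ℝ-log})^gp` after `constDivBsFld^gp` is the transport of `(toR ∘ ι)^gp`. [cite: MochizukiEtTh2009, Def 3.6 p.78] -/
theorem bsFldGpToRlog_gpMap_constDivBsFld (hC : CarrierSpec d T C) (X : T.Dv)
    (z : Algebra.GrothendieckGroup (OrdInt (d.fieldFunctor.obj (T.proj.obj X)).K)) :
    C.bsFldGpToRlog (op X) (gpMap (hC.constDivBsFld X) z) =
      gpMap (T'.ΦR.map (hC.baseIso X).hom.op).hom (gpMap (T'.toR (op X)) (gpMap (hC.constDivIncl (op X)) z)) := by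
  have key : (C.bsFldGpToRlog (op X)).comp (gpMap (hC.constDivBsFld X)) =
      (gpMap (T'.ΦR.map (hC.baseIso X).hom.op).hom).comp
        ((gpMap (T'.toR (op X))).comp (gpMap (hC.constDivIncl (op X)))) := by
    refine MonGp.hom_ext fun x => ?_
    simp only [MonoidHom.comp_apply, gpMap_of, TemperedFrobenioid.bsFldGpToRlog, Submonoid.subtype_apply]
    exact congrArg Algebra.GrothendieckGroup.of (hC.coe_constDivBsFld X x)
  exact DFunLike.congr_fun key z

/-- **`constDivBsFld` is natural**: the pull-back along `g : X → X'` of `ι(ord x)` is `ι(ord (σ_g x))`, the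
ramification being the genuine one (`hC.consts_spec`, naturality of `ι` along `d.fixedHom`). [cite: MochizukiEtTh2009, Def 3.6 p.78] -/
theorem pull_constDivBsFld (hC : CarrierSpec d T C) {X X' : T.Dv} (g : X ⟶ X')
    (x : OrdInt (d.fieldFunctor.obj (T.proj.obj X')).K) :
    C.bsFld.pull g.op (hC.constDivBsFld X' x) =
      hC.constDivBsFld X (ordIntMapOfHom (d.fieldFunctor.map (T.proj.map g)).alg
        (d.fieldFunctor.map (T.proj.map g)).isValHom x) := by
  apply Subtype.ext
  change (T'.ΦR.map (C.base.map g).op).hom ((hC.constDivBsFld X' x : C.bsFld.carrier (op X')) : T'.ΦR.obj (C.baseOp (op X'))) =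
    ((hC.constDivBsFld X (ordIntMapOfHom (d.fieldFunctor.map (T.proj.map g)).alg
        (d.fieldFunctor.map (T.proj.map g)).isValHom x) : C.bsFld.carrier (op X)) : T'.ΦR.obj (C.baseOp (op X)))
  rw [hC.coe_constDivBsFld, hC.coe_constDivBsFld, hC.map_base_map_transport T'.ΦR g, ← T'.toR_natural,
    hC.consts_spec.2.2.2.1 g.op x]
  rfl

/-- **GENUINE CONSTANTS AS CONSTANT FUNCTIONS OF THE HULL at every object** `X` of `𝒟_v̲`:
`(Ω^{aug X})^× → F^{bs}(X) = F₀^Λ(Y_X) ×_{(Φ^{ℝ-log})^gp} (Φ^{bs-fld}(X))^gp`, `u ↦ (κ u, ι^gp(ord u))` — a genuine constant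
with its genuine valuation as a constant rational function of `𝒞^{bs-fld}` (`κ u ∈ F₀^Λ` by `hC.constEmb_mem_FΛ`, `Div (κ u) =
ι^gp(ord u)` by `hC.divΛ_constEmb`).  Constants via `T.proj ⋙ d.fieldFunctor` (crit-A F2). [cite: MochizukiEtTh2009, Def 3.6 p.78] -/
def constCnstFn (hC : CarrierSpec d T C) (X : T.Dv) :
    ((d.fieldFunctor.obj (T.proj.obj X)).K)ˣ →* C.cnstFnBs (op X) :=
  (((hC.trB X).comp (hC.constEmb.app (op X)).hom).prod
      ((gpMap (hC.constDivBsFld X)).comp (divUnits (d.fieldFunctor.obj (T.proj.obj X)).K))).codRestrict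
    (C.cnstFnBs (op X)) fun u => by
      refine ⟨T'.FΛ_map (hC.baseIso X).hom.op _ (hC.constEmb_mem_FΛ (op X) u), ?_⟩
      change T'.divΛ _ ((T'.BΛ.map (hC.baseIso X).hom.op).hom ((hC.constEmb.app (op X)).hom u)) =
        C.bsFldGpToRlog (op X) (gpMap (hC.constDivBsFld X) (divUnits (d.fieldFunctor.obj (T.proj.obj X)).K u))
      rw [T'.divΛ_natural, hC.divΛ_constEmb, hC.bsFldGpToRlog_gpMap_constDivBsFld]

/-- The function component of `constCnstFn u` is (the transport of) `κ u`. [cite: MochizukiEtTh2009, Def 3.6 p.78] -/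
theorem constCnstFn_fst (hC : CarrierSpec d T C) (X : T.Dv) (u : ((d.fieldFunctor.obj (T.proj.obj X)).K)ˣ) :
    (hC.constCnstFn X u).1.1 = hC.trB X ((hC.constEmb.app (op X)).hom u) := rfl

/-- The divisor component of `constCnstFn u` is `ι^gp(ord u)` read in `(Φ^{bs-fld}(X))^gp`. [cite: MochizukiEtTh2009, Def 3.6 p.78] -/
theorem constCnstFn_snd (hC : CarrierSpec d T C) (X : T.Dv) (u : ((d.fieldFunctor.obj (T.proj.obj X)).K)ˣ) :
    (hC.constCnstFn X u).1.2 = gpMap (hC.constDivBsFld X) (divUnits (d.fieldFunctor.obj (T.proj.obj X)).K u) := rfl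

/-- `constCnstFn` is injective (`κ` is). [cite: MochizukiEtTh2009, Def 3.6 p.78] -/
theorem constCnstFn_injective (hC : CarrierSpec d T C) (X : T.Dv) : Injective (hC.constCnstFn X) := fun u v h =>
  hC.constEmb_injective (op X) (hC.trB_injective X
    ((hC.constCnstFn_fst X u).symm.trans ((congrArg (fun b => b.1.1) h).trans (hC.constCnstFn_fst X v))))

/-- **`𝒞^{bs-fld} → 𝒞` maps the hull's genuine constants to GA-06's genuine constants-as-rational-functions**:
`hullUnitM (constCnstFn u) = constRatFn u`. [cite: MochizukiEtTh2009, Def 3.6 p.78] -/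
theorem hullUnitM_constCnstFn (hC : CarrierSpec d T C) (X : T.Dv) (u : ((d.fieldFunctor.obj (T.proj.obj X)).K)ˣ) :
    C.hullUnitM (op X) (hC.constCnstFn X u) = constRatFn hC X u := by
  apply Subtype.ext
  apply Prod.ext
  · rfl
  · have key : (C.bsFldInclGpM (op X)).comp (gpMap (hC.constDivBsFld X)) =
        (gpMap (hC.ofLattice X)).comp (gpMap (hC.constDivIncl (op X))) :=
      MonGp.hom_ext fun x =>
        ((congrArg (C.bsFldInclGpM (op X)) (gpMap_of (hC.constDivBsFld X) x)).trans
          ((C.bsFldInclGpM_of (op X) (hC.constDivBsFld X x)).trans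
            (congrArg Algebra.GrothendieckGroup.of (hC.bsFldInclM_constDivBsFld X x)))).trans
        ((congrArg (gpMap (hC.ofLattice X)) (gpMap_of (hC.constDivIncl (op X)) x)).trans
          (gpMap_of (hC.ofLattice X) (hC.constDivIncl (op X) x))).symm
    exact DFunLike.congr_fun key (divUnits (d.fieldFunctor.obj (T.proj.obj X)).K u)

/-- **`constCnstFn` is natural**: the pull-back along `g : X → X'` of the constant function `κ v` is the constant
function `κ (σ_g v)` (naturality of `κ`, of `ι`, of `K^× → ord(K^×)`). [cite: MochizukiEtTh2009, Def 3.6 p.78] -/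
theorem cnstFnBsPull_constCnstFn (hC : CarrierSpec d T C) {X X' : T.Dv} (g : X ⟶ X')
    (v : ((d.fieldFunctor.obj (T.proj.obj X')).K)ˣ) :
    C.cnstFnBsPull g.op (hC.constCnstFn X' v) =
      hC.constCnstFn X (Units.map ((d.fieldFunctor.map (T.proj.map g)).alg :
        (d.fieldFunctor.obj (T.proj.obj X')).K →* (d.fieldFunctor.obj (T.proj.obj X)).K) v) := by
  apply Subtype.ext
  apply Prod.ext
  · change (T'.BΛ.map (C.base.map g).op).hom (hC.trB X' ((hC.constEmb.app (op X')).hom v)) =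
      hC.trB X ((hC.constEmb.app (op X)).hom (((bZeroOn (T.proj ⋙ d.fieldFunctor)).map g.op).hom v))
    have hκ := congrArg (fun φ => CommMonCat.Hom.hom φ v) (hC.constEmb.naturality g.op)
    simp only [CommMonCat.hom_comp, MonoidHom.comp_apply] at hκ
    rw [hκ]
    exact hC.map_base_map_transport T'.BΛ g _
  · change gpMap (C.bsFld.pull g.op) (gpMap (hC.constDivBsFld X') (divUnits _ v)) =
      gpMap (hC.constDivBsFld X) (divUnits _ (Units.map ((d.fieldFunctor.map (T.proj.map g)).alg :
        (d.fieldFunctor.obj (T.proj.obj X')).K →* (d.fieldFunctor.obj (T.proj.obj X)).K) v))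
    rw [divUnits_map _ (d.fieldFunctor.map (T.proj.map g)).isValHom]
    have key : (gpMap (C.bsFld.pull g.op)).comp (gpMap (hC.constDivBsFld X')) =
        (gpMap (hC.constDivBsFld X)).comp (gpMapOfHom (d.fieldFunctor.map (T.proj.map g)).alg
          (d.fieldFunctor.map (T.proj.map g)).isValHom) := by
      refine MonGp.hom_ext fun x => ?_
      simp only [MonoidHom.comp_apply, gpMap_of, gpMapOfHom_of]
      exact congrArg Algebra.GrothendieckGroup.of (hC.pull_constDivBsFld g x)
    exact DFunLike.congr_fun key (divUnits (d.fieldFunctor.obj (T.proj.obj X')).K v)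

end CarrierSpec

/-! ## §2 `𝒞⊢_v → 𝒞_v`: the morphism of model data over `T.incl : 𝒟⊢_v̲ ⥤ 𝒟_v̲` and the induced functor -/

variable (T) in
/-- `ord(q̲_v)` in `ord(𝒪^▷_{Ω^{aug X}})` — the class of the image of `q̲_v ∈ 𝒪^▷_{K_v̲}` in the base field of `X`
(«the image of `q̲_v` determines a constant section `log_Φ(q̲_v)`»). ([IUTchI] Ex 3.2 (iv) p.71) [claim: Mochizuki2012, status: disputed] -/
def logqOrd (qroot : intNonzero d.k) (X : T.Dv) : OrdInt (d.fieldFunctor.obj (T.proj.obj X)).K :=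
  Associates.mk (d.relEmb.img qroot (T.proj.obj X))

/-- `ord(q̲_v)` is a constant section: pull-backs fix it. ([IUTchI] Ex 3.2 (iv) p.71) [claim: Mochizuki2012, status: disputed] -/
theorem ordIntMapOfHom_logqOrd {qroot : intNonzero d.k} (hq : ¬ IsUnit qroot) {X X' : T.Dv} (g : X ⟶ X') :
    ordIntMapOfHom (d.fieldFunctor.map (T.proj.map g)).alg (d.fieldFunctor.map (T.proj.map g)).isValHom
        (logqOrd T qroot X') = logqOrd T qroot X := by
  rw [logqOrd, ordIntMapOfHom_mk, (d.relEmb.isConstantSection hq).map_eq (T.proj.map g)]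
  rfl

variable (T) in
/-- **The counit `aug(aug⁻¹V) = V` of `T.proj ⊣ T.incl`** at `V ∈ 𝒟⊢_v̲`: the morphism `T.proj (T.incl V) ⟶ V` (an
isomorphism, `aug` being surjective; `T.adj.counit` with its source and target spelled out).
([IUTchI] Ex 3.2 (i) p.70) [claim: Mochizuki2012, status: disputed] -/
def inclCounit (A : CosetCat d.Gal) : T.proj.obj (T.incl.obj A) ⟶ A := T.adj.counit.app A

/-- Naturality of the counit. ([IUTchI] Ex 3.2 (i) p.70) [claim: Mochizuki2012, status: disputed] -/
theorem inclCounit_naturality {A B : CosetCat d.Gal} (f : A ⟶ B) :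
    T.proj.map (T.incl.map f) ≫ inclCounit T B = inclCounit T A ≫ f :=
  T.adj.counit.naturality f

variable (T) in
/-- **`Ω^V → Ω^{aug(aug⁻¹V)}`**: the field homomorphism under the counit `T.proj (T.incl V) ⟶ V` of the adjunction
`T.proj ⊣ T.incl` — HOW the base of `𝒞⊢_v̲` at `V` is read as the base field of the object `T.incl V` of `𝒟_v̲` ("by
pulling back … via the structure morphism"). ([IUTchI] Ex 3.2 (i) p.70) [claim: Mochizuki2012, status: disputed] -/
def counitFieldHom (A : CosetCat d.Gal) :
    (d.fieldFunctor.obj A).K →+* (d.fieldFunctor.obj (T.proj.obj (T.incl.obj A))).K :=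
  (d.fieldFunctor.map (inclCounit T A)).alg

/-- `counitFieldHom` is valuative. ([IUTchI] Ex 3.2 (i) p.70) [claim: Mochizuki2012, status: disputed] -/
theorem counitFieldHom_isValHom (A : CosetCat d.Gal) : IsValHom (counitFieldHom T A) :=
  (d.fieldFunctor.map (inclCounit T A)).isValHom

/-- `counitFieldHom` is injective (a homomorphism of fields). ([IUTchI] Ex 3.2 (i) p.70) [claim: Mochizuki2012, status: disputed] -/
theorem counitFieldHom_injective (A : CosetCat d.Gal) : Injective (counitFieldHom T A) :=
  (counitFieldHom T A).injective

/-- `counitFieldHom` is natural in `V` (naturality of the counit of `T.proj ⊣ T.incl`).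
([IUTchI] Ex 3.2 (i) p.70) [claim: Mochizuki2012, status: disputed] -/
theorem counitFieldHom_comp {A B : CosetCat d.Gal} (f : A ⟶ B) :
    (counitFieldHom T A).comp (d.fieldFunctor.map f).alg =
      (d.fieldFunctor.map (T.proj.map (T.incl.map f))).alg.comp (counitFieldHom T B) := by
  have h' := congrArg (fun k => (d.fieldFunctor.map k).alg) (inclCounit_naturality (T := T) f)
  simp only [Functor.map_comp, PadicFld.comp_alg] at h'
  exact h'.symm

/-- `Φ₀|_{𝒟⊢}` pulled back along the counit IS `(ord σ) ⊗ ℝ_{≥0}` for `σ = counitFieldHom`. ([IUTchI] Ex 3.2 (i) p.70)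
[claim: Mochizuki2012, status: disputed] -/
theorem phi0Map_counit (A : CosetCat d.Gal) :
    phi0Map d.fieldFunctor (inclCounit T A).op =
      Realification.map (ordIntMapOfHom (counitFieldHom T A) (counitFieldHom_isValHom (T := T) A)) := rfl

variable (T) in
/-- The exponent reading `Φ_{𝒞⊢_v}(V) = ℕ·log_Φ(q̲_v) → ord(𝒪^▷_{Ω^{aug(T.incl V)}})`, `n·log_Φ(q̲_v) ↦ n·ord(q̲_v)`
(`ℕ·log_Φ(q̲_v) ≅ ℕ` by `Monogenic.gen_pow_injective`). ([IUTchI] Ex 3.2 (iv) p.71) [claim: Mochizuki2012, status: disputed] -/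
def cdashExp {qroot : intNonzero d.k} (hq : ¬ IsUnit qroot) (A : (CosetCat d.Gal)ᵒᵖ) :
    Submonoid.powers (Monogenic.gen d.fieldFunctor (d.relEmb.img qroot) A.unop) →*
      OrdInt (d.fieldFunctor.obj (T.proj.obj (T.incl.obj A.unop))).K := by
  classical
  exact (powersHom _ (logqOrd T qroot (T.incl.obj A.unop))).comp
    (Submonoid.powLogEquiv (Monogenic.gen_pow_injective d.fieldFunctor (d.relEmb.isConstantSection hq)
      (d.fieldFunctor_isPadicLocal A.unop))).symm.toMonoidHom

/-- `cdashExp (n·log_Φ(q̲_v)) = n·ord(q̲_v)`. ([IUTchI] Ex 3.2 (iv) p.71) [claim: Mochizuki2012, status: disputed] -/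
theorem cdashExp_pow {qroot : intNonzero d.k} (hq : ¬ IsUnit qroot) (A : (CosetCat d.Gal)ᵒᵖ) (n : ℕ) :
    cdashExp T hq A ⟨Monogenic.gen d.fieldFunctor (d.relEmb.img qroot) A.unop ^ n, n, rfl⟩ =
      logqOrd T qroot (T.incl.obj A.unop) ^ n := by
  classical
  have e₁ : (⟨Monogenic.gen d.fieldFunctor (d.relEmb.img qroot) A.unop ^ n, n, rfl⟩ :
      Submonoid.powers (Monogenic.gen d.fieldFunctor (d.relEmb.img qroot) A.unop)) = Submonoid.pow _ n := rfl
  rw [cdashExp, e₁, MonoidHom.comp_apply, MulEquiv.coe_toMonoidHom, Submonoid.powLogEquiv_symm_apply,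
    Submonoid.log_pow_eq_self (Monogenic.gen_pow_injective d.fieldFunctor (d.relEmb.isConstantSection hq)
      (d.fieldFunctor_isPadicLocal A.unop)), powersHom_apply, toAdd_ofAdd]

/-- `ord(𝒪^▷) ⊗ 1` after `cdashExp` is the pull-back of `Φ_{𝒞⊢_v} ⊆ Φ₀|_{𝒟⊢}` along the counit: `[cdashExp z] ⊗ 1 = Φ₀(ε)(z)`.
([IUTchI] Ex 3.2 (iv) p.71) [claim: Mochizuki2012, status: disputed] -/
theorem realificationOf_comp_cdashExp {qroot : intNonzero d.k} (hq : ¬ IsUnit qroot) (A : (CosetCat d.Gal)ᵒᵖ) :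
    (Realification.of _).comp (cdashExp T hq A) =
      (phi0Map d.fieldFunctor (inclCounit T A.unop).op).comp (Submonoid.powers _).subtype := by
  refine MonoidHom.ext fun z => ?_
  obtain ⟨_, n, rfl⟩ := z
  calc (Realification.of _).comp (cdashExp T hq A) ⟨_, n, rfl⟩
      = Realification.of _ (logqOrd T qroot (T.incl.obj A.unop) ^ n) :=
        congrArg (Realification.of _) (cdashExp_pow hq A n)
    _ = Monogenic.gen d.fieldFunctor (d.relEmb.img qroot) (T.proj.obj (T.incl.obj A.unop)) ^ n := map_pow _ _ n
    _ = phi0Map d.fieldFunctor (inclCounit T A.unop).op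
          (Monogenic.gen d.fieldFunctor (d.relEmb.img qroot) A.unop) ^ n := by
        rw [Monogenic.phi0Map_gen d.fieldFunctor (d.relEmb.isConstantSection hq)]
    _ = phi0Map d.fieldFunctor (inclCounit T A.unop).op
          (Monogenic.gen d.fieldFunctor (d.relEmb.img qroot) A.unop ^ n) := (map_pow _ _ n).symm

/-- The `K^×`-component of the pull-back maps of `B_{𝒞⊢_v}` is the field map. ([IUTchI] Ex 3.2 (iv) p.71)
[claim: Mochizuki2012, status: disputed] -/
theorem BMap_fst_eq {qroot : intNonzero d.k} (hq : ¬ IsUnit qroot) {A B : (CosetCat d.Gal)ᵒᵖ} (f : A ⟶ B)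
    (u : Monogenic.BSub d.fieldFunctor (d.relEmb.isConstantSection hq) A) :
    ((Monogenic.BMap d.fieldFunctor (d.relEmb.isConstantSection hq) f u).1.1 : ((d.fieldFunctor.obj B.unop).K)ˣ) =
      Units.map ((d.fieldFunctor.map f.unop).alg : (d.fieldFunctor.obj A.unop).K →* (d.fieldFunctor.obj B.unop).K)
        u.1.1 := rfl

/-- The fibre-product condition of `B_{𝒞⊢_v}(V) = (Ω^V)^× ×_{Φ₀^gp} (ℕ·log_Φ(q̲_v))^gp`: `ord x ⊗ 1 = γ` read in
`(ord(𝒪^▷) ⊗ ℝ_{≥0})^gp`. ([IUTchI] Ex 3.2 (iv) p.71) [claim: Mochizuki2012, status: disputed] -/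
theorem divZeroHom_eq_of_mem_BSub {qroot : intNonzero d.k} (hq : ¬ IsUnit qroot) (A : (CosetCat d.Gal)ᵒᵖ)
    (u : Monogenic.BSub d.fieldFunctor (d.relEmb.isConstantSection hq) A) :
    divZeroHom (d.fieldFunctor.obj A.unop).K u.1.1 =
      MonGp.map (Submonoid.powers (Monogenic.gen d.fieldFunctor (d.relEmb.img qroot) A.unop)).subtype u.1.2 :=
  (Monogenic.mem_BSub_iff d.fieldFunctor (d.relEmb.isConstantSection hq) A u.1).mp u.2

/-- **A morphism of `𝒞⊢_v̲` is determined by `deg_Fr`, `Base` and the `K^×`-component of its unit, I**: the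
`(ℕ·log_Φ(q̲_v))^gp`-component of the unit is recovered from the `K^×`-component through the fibre-product condition
(`ord(𝒪^▷) ⊗ ℝ_{≥0}` is integral). ([IUTchI] Ex 3.2 (iv) p.71) [claim: Mochizuki2012, status: disputed] -/
theorem Cdash.unit_eq_of_fst_eq {qroot : intNonzero d.k} (hq : ¬ IsUnit qroot) {X Y : d.Cdash hq} (φ ψ : X ⟶ Y)
    (hx : (ModelFrobenioid.unit φ).1.1 = (ModelFrobenioid.unit ψ).1.1) :
    ModelFrobenioid.unit φ = ModelFrobenioid.unit ψ := by
  haveI := isCancelMul_realification (OrdInt (d.fieldFunctor.obj X.base).K)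
  refine Subtype.ext (Prod.ext hx ?_)
  have e1 := divZeroHom_eq_of_mem_BSub hq (op X.base) (ModelFrobenioid.unit φ)
  have e2 := divZeroHom_eq_of_mem_BSub hq (op X.base) (ModelFrobenioid.unit ψ)
  exact MonGp.map_injective _ Subtype.val_injective
    (e1.symm.trans ((congrArg (divZeroHom (d.fieldFunctor.obj X.base).K) hx).trans e2))

/-- **A morphism of `𝒞⊢_v̲` is determined by `deg_Fr`, `Base` and the `K^×`-component of its unit, II**: the zero
divisor is recovered from relation (d) of [FrdI] Thm. 5.2 (i) (`ℕ·log_Φ(q̲_v)` is integral).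
([IUTchI] Ex 3.2 (iv) p.71) [claim: Mochizuki2012, status: disputed] -/
theorem Cdash.div_eq_of_eq {qroot : intNonzero d.k} (hq : ¬ IsUnit qroot) {X Y : d.Cdash hq} (φ ψ : X ⟶ Y)
    (h1 : ModelFrobenioid.degFr φ = ModelFrobenioid.degFr ψ) (h2 : ModelFrobenioid.baseMap φ = ModelFrobenioid.baseMap ψ)
    (hu : ModelFrobenioid.unit φ = ModelFrobenioid.unit ψ) : ModelFrobenioid.div φ = ModelFrobenioid.div ψ := by
  haveI := isCancelMul_realification (OrdInt (d.fieldFunctor.obj X.base).K)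
  have r1 := ModelFrobenioid.rel φ
  rw [h1, h2, hu] at r1
  have e := mul_left_cancel (r1.trans (ModelFrobenioid.rel ψ).symm)
  let sub := (Submonoid.powers (Monogenic.gen d.fieldFunctor (d.relEmb.img qroot) X.base)).subtype
  have e' : Algebra.GrothendieckGroup.of (sub (ModelFrobenioid.div φ)) =
      Algebra.GrothendieckGroup.of (sub (ModelFrobenioid.div ψ)) :=
    (MonGp.map_of sub _).symm.trans ((congrArg (MonGp.map sub) e).trans (MonGp.map_of sub _))
  exact Subtype.ext (Algebra.GrothendieckGroup.of_injective e')

end ArithThetaTower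

end Literature.AnabelianGeometry.EtaleTheta

end
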